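import Summits.ValiantsHypothesis.ValiantsHypothesis.Theorems.ApLowerBound
import Summits.ValiantsHypothesis.ValiantsHypothesis.Theorems.SOSRoad
import Mathlib.Data.Nat.Choose.Central
import HarnessLib

/-!
# `AP_k` is superpolynomially hard for noncommutative syntactically multilinear circuits — the DECIDED
# sibling of `PerNotSmVP` (23661) and `PerNotNcVP` (`A_nc`) in their own grammar (kernel)

Decomposition workshop `decomp-valiant`, lens 6 «restricted-models lifting axis», gen 4, move K5c of
the node `CommutativityDial`, packaging. `ApLowerBound.choose_le_of_computes_apPoly` (HWY10 Thm 1.12)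
gives `C(k,d) ≤ (k+1)·size` for some `k/3 ≤ d < 2k/3`; here it is turned into the two shapes the route
speaks:

* `two_pow_le_choose` — `2^{⌊k/3⌋} ≤ C(k,d)` on that range (via `C(k,d) ≥ C(2m,m) > 4^m/m`, Erdős's
  bound `Nat.four_pow_lt_mul_centralBinom`), hence `two_pow_le_size : 2^{⌊k/3⌋} ≤ (k+1)·P.size`
  (`k ≥ 12`);
* `apNotNcSmVP` — `∀ c, ∃ k, ∀ P, P.IsFanInTwo → IsSyntacticallyMultilinear P → ncEval P = apPoly F k
  → k^c + c < P.size`: LITERALLY the statement shape of the crux `DecompCycle1.PerNotSmVP` (item 23661)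
  and of the dial's conjunct `CommutativityDial.PerNotNcVP`, with BOTH their restrictions imposed at
  once (noncommutative evaluation AND syntactic multilinearity) and the all-permutations polynomial in
  place of the (ordered) permanent — and it is a THEOREM (every field).

HONEST FRAMING: a decided rung strictly below both open cruxes (for the ORDERED permanent syntactic
multilinearity is free, HWY §F.1 = `NcOrderedTransfer.exists_sm_of_nc`, so the analogous statement for
`ncPerPoly` is `A_nc` up to polynomial factors); nothing here bears on `VP ≠ VNP`.

## References
* [HrubesWigdersonYehudayoff2010] P. Hrubeš, A. Wigderson, A. Yehudayoff, Relationless completeness and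
  separations, CCC 2010 / ECCC TR10-021, Thm 1.12.
* [Nisan1991Noncommutative] N. Nisan, Lower bounds for non-commutative computation, STOC 1991.
-/

namespace Summit.ValiantsHypothesis.ValiantsHypothesis.Theorems.ApNotNcSmVP

open Literature.Computability.AlgebraicComplexity hiding ncPerPoly
open Literature.Computability.AlgebraicComplexity.ArithCircuit hiding ncGateValues ncEval
open Summit.ValiantsHypothesis.ValiantsHypothesis.Theorems.CommutativityDial
open Summit.ValiantsHypothesis.ValiantsHypothesis.Theorems.ApLowerBound

/-- `2^m ≤ C(2m, m)` for `m ≥ 4` (from Erdős's `4^m < m · C(2m,m)`). [folklore] -/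
theorem two_pow_le_centralBinom {m : ℕ} (hm : 4 ≤ m) : 2 ^ m ≤ (2 * m).choose m := by
  rw [← Nat.centralBinom_eq_two_mul_choose]
  have h4 : 4 ^ m < m * Nat.centralBinom m := Nat.four_pow_lt_mul_centralBinom m hm
  have hm2 : m < 2 ^ m := Nat.lt_two_pow_self
  have e : 4 ^ m = 2 ^ m * 2 ^ m := by rw [← mul_pow]; norm_num
  by_contra h
  rw [not_le] at h
  have : m * Nat.centralBinom m < 2 ^ m * 2 ^ m :=
    Nat.mul_lt_mul'' hm2 h
  omega

/-- **Exponential form of the balanced binomial**: for `12 ≤ k` and `k/3 ≤ d < 2k/3`,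
`2^{⌊k/3⌋} ≤ C(k, d)`. [folklore] -/
theorem two_pow_le_choose {k d : ℕ} (hk : 12 ≤ k) (h1 : k ≤ 3 * d) (h2 : 3 * d < 2 * k) :
    2 ^ (k / 3) ≤ k.choose d := by
  -- the smaller side `m = min (d, k - d)` satisfies `k/3 ≤ m`, `2m ≤ k`, `C(k,d) = C(k,m)`
  obtain ⟨m, hm3, h2m, hcd⟩ : ∃ m, k / 3 ≤ m ∧ 2 * m ≤ k ∧ k.choose d = k.choose m := by
    by_cases hd : 2 * d ≤ k
    · exact ⟨d, by omega, hd, rfl⟩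
    · refine ⟨k - d, by omega, by omega, ?_⟩
      rw [Nat.choose_symm (by omega)]
  rw [hcd]
  have hm4 : 4 ≤ m := by omega
  calc 2 ^ (k / 3) ≤ 2 ^ m := Nat.pow_le_pow_right (by norm_num) hm3
    _ ≤ (2 * m).choose m := two_pow_le_centralBinom hm4
    _ ≤ k.choose m := Nat.choose_le_choose m h2m

variable {F : Type} [Field F]

/-- **HWY Thm 1.12, exponential form**: a fan-in-two syntactically multilinear circuit with noncommutative
value `AP_k` (`k ≥ 12`) has `(k + 1) · size ≥ 2^{⌊k/3⌋}`. [cite: HrubesWigdersonYehudayoff2010, Thm 1.12] -/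
theorem two_pow_le_size {k : ℕ} (hk : 12 ≤ k) (P : ArithCircuit F (Fin k)) (h2 : P.IsFanInTwo)
    (hsm : IsSyntacticallyMultilinear P) (hP : ncEval P = apPoly F k) :
    2 ^ (k / 3) ≤ (k + 1) * P.size := by
  obtain ⟨d, h1, h3, hc⟩ := choose_le_of_computes_apPoly (by omega) P h2 hsm hP
  exact (two_pow_le_choose hk h1 h3).trans hc

/-- Polynomial versus exponential, in the shape needed below. [folklore] -/
theorem exists_poly_lt (c : ℕ) : ∃ n, 4 ≤ n ∧ (3 * n + 1) * ((3 * n) ^ c + c) < 2 ^ n := by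
  obtain ⟨n, hn, hlt⟩ := SOSRoad.exists_poly_lt_two_pow (c + 1) 3 (max 4 (3 ^ c))
  have hn4 : 4 ≤ n := le_trans (le_max_left _ _) hn
  have hn3 : 3 ^ c ≤ n := le_trans (le_max_right _ _) hn
  refine ⟨n, hn4, lt_of_le_of_lt ?_ hlt⟩
  -- with `X = n^{c+1} + (c+1) + 1`: `3n + 1 ≤ (n+2)² ≤ X²` and `(3n)^c + c ≤ n·n^c + c ≤ X`
  have hX : n + 2 ≤ n ^ (c + 1) + (c + 1) + 1 := by
    have : n ≤ n ^ (c + 1) := Nat.le_self_pow (Nat.succ_ne_zero c) n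
    omega
  have hA : 3 * n + 1 ≤ (n ^ (c + 1) + (c + 1) + 1) ^ 2 :=
    le_trans (by nlinarith) (Nat.pow_le_pow_left hX 2)
  have hB : (3 * n) ^ c + c ≤ n ^ (c + 1) + (c + 1) + 1 := by
    rw [mul_pow, pow_succ']
    have := Nat.mul_le_mul_right (n ^ c) hn3
    omega
  calc (3 * n + 1) * ((3 * n) ^ c + c)
      ≤ (n ^ (c + 1) + (c + 1) + 1) ^ 2 * (n ^ (c + 1) + (c + 1) + 1) := Nat.mul_le_mul hA hB
    _ = (n ^ (c + 1) + (c + 1) + 1) ^ 3 := by ring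

/-- **`AP` is superpolynomially hard for nc ∧ syntactically multilinear circuits** — the decided sibling
of `PerNotSmVP` (23661) and `PerNotNcVP` (`A_nc`) in their exact grammar: for every exponent `c` some
`AP_k` needs more than `k^c + c` gates from every fan-in-two syntactically multilinear circuit computing
it noncommutatively. [cite: HrubesWigdersonYehudayoff2010, Thm 1.12] -/
theorem apNotNcSmVP : ∀ c : ℕ, ∃ k : ℕ, ∀ P : ArithCircuit F (Fin k), P.IsFanInTwo →
    IsSyntacticallyMultilinear P → ncEval P = apPoly F k → k ^ c + c < P.size := by
  intro c
  obtain ⟨n, hn4, hlt⟩ := exists_poly_lt c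
  refine ⟨3 * n, fun P h2 hsm hP => ?_⟩
  have h := two_pow_le_size (k := 3 * n) (by omega) P h2 hsm hP
  rw [Nat.mul_div_cancel_left n (by norm_num)] at h
  by_contra hle
  rw [not_lt] at hle
  have : (3 * n + 1) * P.size ≤ (3 * n + 1) * ((3 * n) ^ c + c) := Nat.mul_le_mul_left _ hle
  omega

end Summit.ValiantsHypothesis.ValiantsHypothesis.Theorems.ApNotNcSmVP
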